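import Literature.MathematicalPhysics.QuantumFieldTheory.Balaban1983to89.B9Eq3126H1kPiSupRowClosed
import Literature.MathematicalPhysics.QuantumFieldTheory.Balaban1983to89.B9Eq326LocalPartTowerSupDecayDiagonalClosed
import Literature.MathematicalPhysics.QuantumFieldTheory.Balaban1983to89.B11Eq117ReadLettersBridge

/-!
# `Balaban1983to89.B9Eq3126H1kPiOneBlockColumn` — T. Bałaban, *Propagators for lattice gauge theories in a background field*, Commun. Math. Phys. **99** (1985) 389–434
# [Balaban1985BackgroundPropagators] (3.126) p. 420, Thm 3.12 (3.133) pp. 422–423, (3.49) p. 399; [Balaban1985Variational] (46) p. 285, (85)–(86) p. 291, (103) p. 293: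
# **THE ONE-BLOCK LETTER OF `H̃_{1,k} = G̃_kQ_k†(Q_kG̃_kQ_k†)⁻¹` READ IN THE (115) CARRIER AND ITS FINE-COLUMN SUM** — print's kernel size `|H(b, c)| ≤ O(1)e^{−δd}`
# ((46), from [5] Thm 3.12) for ONE coarse bond `c`, `∃ (α₁, j₁, B, δ)` BEFORE the lattice ((K81) `B9Eq3126H1kPiSupRowClosed` at a one-bond support through
# `H1CLM_apply` and the fibre prices), and the fine-column sum of the decay profile `Σ_b e^{−δd_m(Π(b₋), c₋)} ≤ d·(L^{n+1})^d·K_d(δ)` — the letters `hk`, `Θ_H`,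
# `Θ_H^w` consumed by this generation's `B11Eq73KernelColumnsCarrier` (the kernel route (73) → (86) for a lattice-free `θ_E` of the W-slot)

statement-level skeleton of published theorems with citation tags; proofs where landed; nothing here is a claim about the Yang–Mills mass gap

CITATION HEADER (lean-in-tree rule).  Audit cell `pub-balaban`, sub-cell `t4`, BINDER row NE9; NE9 crux-team LEAF PROVER 01 (`b2b-balaban-t4-ne9-formalise-leaf-01`, gen 97;
bears_on: R4/N22).  Composed BY NAME, nothing restated: (K81) `exists_local_letter_H1LatticeKPi`, `B11Eq103H1Complex.H1CLM_apply` ∕ `funEquiv_symm_apply`,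
`B9Eq326LocalPartTowerSupDecayDiagonalClosed.sum_bondMass_bigBlock_le`, `B4Sect5Torus.torusSum_le`.  Sources read through the audited headers of (K81) and
`B11Eq117ReadLettersBridge` (`paper:balaban1985-cmp99-background-propagators` pp. 399, 420–423; `paper:balaban1985-cmp102-variational-background` pp. 285, 291, 293).
NOTHING of print's proof is reproduced; no constant of print is valued.

THE PRINT (verbatim, [B11] p. 291 (86)): *«|…| ≤ Σ_j Σ_{y∈Λ_j} Σ_{b′∈B_j(y)} (Lʲη)^d |J(b′)||H(b′, c)||𝔇₃(A′; c, b)| ≤ …»* — the sum over the FINE bonds `b′` of one block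
of `|H(b′, c)|` is what this file's §1 bounds (`d·(L^{n+1})^d` bonds × the torus sum of the decay).

WHAT IS PROVED (sorry-free; proof lane — no `def`).
* §1 **`sum_fine_exp_block_le`** — `Σ_{b fine} e^{−δ·d_m(Π(b₋), v)} ≤ d·(L^{n+1})^d·K_d(δ)`; `sum_fine_weight_exp_block_le` — the same with a fine weight `0 ≤ r ≤ ϖ`.
* §2 **`exists_oneBlock_letter_H1LatticeCLM`** — `∃ α₁ j₁ B δ` BEFORE (K81)'s binder block VERBATIM through `hQ`, then for every level profile and carrier data
  `(lev₀ lev₁ Dc levB)`, every coarse bond `c`, fibre value `Z` and fine bond `b`: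
  `‖(H̃_{1,k}(δ_cZ))(b)‖ ≤ M_φ·B·M_φ′·e^{−δ·d_m(Π(b₋), c₋)}·‖Z‖` for `H̃_{1,k} = B11Eq103H1Complex.H1LatticeCLM φ hposπ hQ lev₁ Dc`, `δ_cZ = (NegSup.equiv …).symm (Pi.single c Z)`.
HONEST SCOPE.  The coarse → fine one-block letter only (height-free because its source is ONE coarse bond); together with §1 the fine-column letter
`Θ_H = M_φBM_φ′·d·(L^{n+1})^d·K_d(δ)` carries the block volume `d·L^{(n+1)d} = d·η^{−d}`, which the `L^{−kd}` of the `C′`-letter (`B11Eq44CKernelColumnTower`)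
cancels; constants crude; `hpos′`, `hpos`, `hposπ`, `hQ`, the windows, the level data, `c₀ = η^d`, `‖J‖ ≤ j₀` stay HYPOTHESES; nothing of [B9] Thm 3.12 or [B11] (46)
asserted; «NE9 ⇐ the named binders»; NE9 NOT PRINTED ∕ NOT PROVED; row WALLED ON A MODEL (O-NE9-1; #5 UNRULED); spine PROVED 0∕9; rung (B)+1 on a finite T⁴ — NOT
infinite volume, NOT mass gap, NOT BetaPertH, NOT Clay.  HONEST DEPENDENCY: continuum YM on T⁴ ⇐ BetaPertH ∧ nine spine estimates (0/9 proved); BetaPertH ⇐ (D1) ∧ (D4)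
∧ CAP+tail; G-an2-4 gates asym, D1 and NE2/3/4.  NEW file; imports (K81), `B9Eq326LocalPartTowerSupDecayDiagonalClosed`, `B11Eq117ReadLettersBridge`; nothing modified.
Net new unproved facts: 0.
-/

noncomputable section

set_option autoImplicit false

open scoped InnerProductSpace ComplexConjugate BigOperators

namespace Literature.MathematicalPhysics.QuantumFieldTheory.Balaban1983to89.B9Eq3126H1kPiOneBlockColumn

open B4Sect5Torus (TSite tdist tdist_nonneg tdist_symm tdist_self tdist_triangle torusSum_le)
open B4Sect5Proof (latticeConst latticeConst_nonneg)
open B9SectCLatticeCarrier (Bond DirPair bpos btgt shift unshift)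
open B9Eq311L2Pairing (WL2)
open B9Eq319QprimeTorus (fineP blockCoord)
open B7Prop1Explicit (U1 Wcx boxVec)
open B11Eq103H1Complex (SiteL2K BondL2K greenK covDerivL2K covDivL2K G1LatticeK KinvLatticeK H1LatticeK H1LatticeK_eq)
open B9Eq310DeltaPrime (plaqHolU)
open B9Eq310HessianOperator (adTransportW hessOp)
open B9Eq310HessianHermitian (adTransportW_adjoint)
open B9Eq315QTorus (perCfg cornerSite)
open B9Eq315QTower (towerP UlevOf)
open B9Eq316TowerFlatIsOneStep (towerP_eq_fineP_pow siteCast)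
open B9Eq326OperatorTower (QprimeTowerW QkW RofUk laplaceAk G1k)
open B9Eq324DeltaPrimeATower (laplacePrimeAk GpOfUk)
open B9Eq33CovDerivLocalLetterTower (tdist_bigBlock_bpos_btgt_le_one)
open B9Eq3117GaugeModeStencilLettersTower (local_hessOp_covDerivL2K_tower local_covDivL2K_hessOp_tower)
open B9Eq3130GtildePairRowsClosedTower (exists_local_letters_G1LatticeKPi)
open B9Eq3132QGtildeQInvLetterClosed (exists_local_letter_KinvLatticeKPi)
open B9Eq3119DeltaPiTower (piOfUk laplaceAkPi)

open B9Eq3126H1kPiSupRowClosed (exists_local_letter_H1LatticeKPi)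
open B9Eq326LocalPartTowerSupDecayDiagonalClosed (sum_bondMass_bigBlock_le)
open B11Eq103H1Complex (H1LatticeCLM H1CLM_apply funEquiv funEquiv_symm_apply)
open B11Eq115Space

variable {d : ℕ} (hd : 1 ≤ d) (L : ℕ) [NeZero L] (hL : 1 ≤ L) (hL3 : 3 ≤ L)
  {𝔸 : Type*} [NormedRing 𝔸] [NormedAlgebra ℂ 𝔸] [CompleteSpace 𝔸] [NormOneClass 𝔸] [StarRing 𝔸] [NormedStarGroup 𝔸] [StarModule ℂ 𝔸]
  {W : Type*} [NormedAddCommGroup W] [InnerProductSpace ℂ W] [FiniteDimensional ℂ W] (φ : W ≃ₗ[ℂ] 𝔸)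
  {Mφ Mφ' : ℝ} (hMφ : 0 ≤ Mφ) (hMφ' : 0 ≤ Mφ') (hφ : ∀ w, ‖φ w‖ ≤ Mφ * ‖w‖) (hφ' : ∀ X, ‖φ.symm X‖ ≤ Mφ' * ‖X‖) (hstar : ∀ X : 𝔸, ‖star X‖ ≤ ‖X‖)
  {a : ℝ} (ha : 0 < a) {a' : ℝ} (ha' : 0 < a') {ϱ : ℝ} (hϱ0 : 0 ≤ ϱ) (hϱ1 : ϱ < 1)
  (τ : 𝔸 →ₗ[ℂ] ℂ) {Cτ : ℝ} (hτ : ∀ X, ‖τ X‖ ≤ Cτ * ‖X‖) (hCτ : 0 ≤ Cτ) {Mτ : ℝ} (hτm : ∀ X Y : 𝔸, ‖τ (X * Y)‖ ≤ Mτ * ‖X‖ * ‖Y‖) (hMτ : 0 ≤ Mτ)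
  {ρw : ℝ} (hρw : 0 ≤ ρw)
  (hτ₁ : ∀ X : 𝔸, τ (star X) = conj (τ X)) (hτ₂ : ∀ X Y : 𝔸, τ (X * Y) = τ (Y * X)) (hφτ : ∀ X Y : 𝔸, ⟪φ.symm X, φ.symm Y⟫_ℂ = τ (star X * Y))
  (AQ : ℝ)


/-! ## §1 The fine-column sum of a block-decay profile: `d·(L^{n+1})^d` fine bonds per big block times the torus sum -/

/-- **THE FINE-COLUMN SUM OF A BLOCK-DECAY PROFILE**: `Σ_{b fine} e^{−δ·d_m(Π(b₋), v)} ≤ d·(L^{n+1})^d·K_d(δ)` — the `d·(L^{n+1})^d` fine bonds of one big block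
(`sum_bondMass_bigBlock_le`) times the torus sum `Σ_w e^{−δ d_m(w, v)} ≤ K_d(δ)` (`torusSum_le`); the «block volume» `d·L^{(n+1)d} = d·η^{−d}` of the
fine column of `H̃_k`'s kernel. [cite: Balaban1985BackgroundPropagators, (3.49) p.399, (3.126) p.420; Balaban1985Averaging, (2) p.17] -/
theorem sum_fine_exp_block_le (n : ℕ) (m : Fin d → ℕ) [∀ i, NeZero (m i)] (hm : ∀ i, 1 ≤ m i) {δ : ℝ} (hδ : 0 < δ) (v : TSite d m) :
    ∑ b : Bond d (towerP L m (n + 1)), Real.exp (-(δ * tdist m (blockCoord (L ^ (n + 1)) m (siteCast (towerP_eq_fineP_pow L m (n + 1)) (bpos b))) v)) ≤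
      d * ((L : ℝ) ^ (n + 1)) ^ d * latticeConst d δ := by
  classical
  have hf : ∀ b : Bond d (towerP L m (n + 1)), Real.exp (-(δ * tdist m (blockCoord (L ^ (n + 1)) m (siteCast (towerP_eq_fineP_pow L m (n + 1)) (bpos b))) v)) =
      ∑ w : TSite d m, (if blockCoord (L ^ (n + 1)) m (siteCast (towerP_eq_fineP_pow L m (n + 1)) b.1) = w then (1 : ℝ) else 0) *
        Real.exp (-(δ * tdist m w v)) := fun b => by
    rw [Finset.sum_eq_single (blockCoord (L ^ (n + 1)) m (siteCast (towerP_eq_fineP_pow L m (n + 1)) (bpos b)))]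
    · simp [bpos]
    · intro w _ hw; rw [if_neg (Ne.symm hw), zero_mul]
    · simp
  simp_rw [hf]
  rw [Finset.sum_comm]
  calc ∑ w : TSite d m, ∑ b : Bond d (towerP L m (n + 1)),
          (if blockCoord (L ^ (n + 1)) m (siteCast (towerP_eq_fineP_pow L m (n + 1)) b.1) = w then (1 : ℝ) else 0) * Real.exp (-(δ * tdist m w v))
      ≤ ∑ w : TSite d m, (1 * (d * ((L : ℝ) ^ (n + 1)) ^ d)) * Real.exp (-(δ * tdist m w v)) := Finset.sum_le_sum fun w _ => by
        rw [← Finset.sum_mul]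
        exact mul_le_mul_of_nonneg_right (sum_bondMass_bigBlock_le L m n zero_le_one w) (Real.exp_nonneg _)
    _ = d * ((L : ℝ) ^ (n + 1)) ^ d * ∑ w : TSite d m, Real.exp (-(δ * tdist m w v)) := by rw [← Finset.mul_sum]; ring
    _ ≤ d * ((L : ℝ) ^ (n + 1)) ^ d * latticeConst d δ :=
        mul_le_mul_of_nonneg_left (by simpa [tdist_symm hm] using torusSum_le d hm hδ v) (by positivity)

include hd in
/-- … and with a bounded fine weight `0 ≤ r(b) ≤ ϖ` (the `|·|_{(−3)}`-ratio `(Lʲ⁽ᵇ⁰⁾η)³/(Lʲ⁽ᵇ⁾η)³` of (86), bounded through the weight-profile letters):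
`Σ_b r(b)e^{−δ·d_m(Π(b₋), v)} ≤ ϖ·d·(L^{n+1})^d·K_d(δ)`. [cite: Balaban1985BackgroundPropagators, (3.49) p.399; Balaban1985Variational, (86) p.291] -/
theorem sum_fine_weight_exp_block_le (n : ℕ) (m : Fin d → ℕ) [∀ i, NeZero (m i)] (hm : ∀ i, 1 ≤ m i) {δ : ℝ} (hδ : 0 < δ) (v : TSite d m)
    {r : Bond d (towerP L m (n + 1)) → ℝ} {ϖ : ℝ} (hr0 : ∀ b, 0 ≤ r b) (hr : ∀ b, r b ≤ ϖ) :
    ∑ b : Bond d (towerP L m (n + 1)), r b * Real.exp (-(δ * tdist m (blockCoord (L ^ (n + 1)) m (siteCast (towerP_eq_fineP_pow L m (n + 1)) (bpos b))) v)) ≤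
      ϖ * (d * ((L : ℝ) ^ (n + 1)) ^ d * latticeConst d δ) := by
  calc _ ≤ ∑ b : Bond d (towerP L m (n + 1)), ϖ * Real.exp (-(δ * tdist m (blockCoord (L ^ (n + 1)) m (siteCast (towerP_eq_fineP_pow L m (n + 1)) (bpos b))) v)) :=
        Finset.sum_le_sum fun b _ => mul_le_mul_of_nonneg_right (hr b) (Real.exp_nonneg _)
    _ ≤ _ := by
        rw [← Finset.mul_sum]
        have hϖ : 0 ≤ ϖ := by
          obtain ⟨b⟩ : Nonempty (Bond d (towerP L m (n + 1))) := ⟨(fun i => ⟨0, Nat.pos_of_ne_zero (NeZero.ne _)⟩, ⟨0, hd⟩)⟩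
          exact (hr0 b).trans (hr b)
        exact mul_le_mul_of_nonneg_left (sum_fine_exp_block_le L n m hm hδ v) hϖ

/-! ## §2 The one-block letter of `H̃_{1,k}` read in the (115) carrier: print's `|H(b, c)|` with decay, height-free, ∃-first -/

set_option maxRecDepth 8192 in
set_option maxHeartbeats 800000 in -- (K81)'s ≈ 50-binder block
include hd hL hL3 hMφ hMφ' hφ hφ' hstar ha ha' hϱ0 hϱ1 hτ hCτ hτm hMτ hρw hτ₁ hτ₂ hφτ in
/-- **THE ONE-BLOCK LETTER OF `H̃_{1,k} = G̃_kQ_k†(Q_kG̃_kQ_k†)⁻¹` IN THE (115) CARRIER** — print's kernel bound `|H(b, c)| ≤ O(1)e^{−δd}` ((46); [5] Thm 3.12): for the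
block field `δ_cZ` supported at ONE coarse bond `c` with value `Z`, at every fine bond `b`:
`‖(H̃_{1,k}(δ_cZ))(b)‖ ≤ M_φ·B·M_φ′·e^{−δ·d_m(Π(b₋), c₋)}·‖Z‖`, `∃ (α₁, j₁, B, δ)` BEFORE the lattice — (K81) `exists_local_letter_H1LatticeKPi` at the
one-bond support through `H1CLM_apply` and the fibre prices `M_φ, M_φ′`.  The letter `hk(b, c)` of this generation's `B11Eq73KernelColumnsCarrier`.
[cite: Balaban1985Variational, (46) p.285, (85) p.291, (103) p.293; Balaban1985BackgroundPropagators, (3.126) p.420, Thm 3.12 p.423] -/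
theorem exists_oneBlock_letter_H1LatticeCLM :
    ∃ α₁ j₁ B δ : ℝ, 0 < α₁ ∧ 0 < j₁ ∧ 0 ≤ B ∧ 0 < δ ∧
      ∀ (n : ℕ) (η : ℝ) (_hηL : η * (L : ℝ) ^ (n + 1) = 1) (c₀ c₁ : ℝ) [Fact (0 < c₀)] [Fact (0 < c₁)]
        (_hw : c₀ * ((L : ℝ) ^ (n + 1)) ^ d = c₁) (_hρ : |η| ^ d / c₀ ≤ ρw) (m : Fin d → ℕ) [∀ i, NeZero (m i)] (_hm : ∀ i, 1 ≤ m i)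
        (U : Bond d (towerP L m (n + 1)) → 𝔸ˣ) (αU : ℕ → ℝ) (_hα0 : ∀ j, 0 ≤ αU j) (hα1 : ∀ j, αU j ≤ 1 / 64)
        (hαL : ∀ j, 50 * (d + 1) * αU j * (L : ℝ) ^ d ≤ 1 / 2)
        (hU1 : ∀ (j : ℕ) (x : B7Prop1Explicit.Site d) (k : Fin d), perCfg (towerP L m (j + 1)) (UlevOf L m (n + 1) U j) x k ∈ U1 𝔸)
        (hreg : ∀ (j : ℕ) (y : TSite d (towerP L m j)) (k : Fin d) (ρ' : Fin d → Fin L),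
          ‖((Wcx L (perCfg (towerP L m (j + 1)) (UlevOf L m (n + 1) U j)) (cornerSite L y) k (boxVec L ρ') : 𝔸ˣ) : 𝔸) - 1‖ ≤ αU j)
        (εU : ℕ → ℝ) (_hεU : ∀ j, 0 ≤ εU j) (_hUε : ∀ (j : ℕ) (b : Bond d (towerP L m (j + 1))), ‖(UlevOf L m (n + 1) U j b : 𝔸) - 1‖ ≤ εU j)
        (_hLb : ∀ (j : ℕ) (b : Bond d (towerP L m (j + 1))), UlevOf L m (n + 1) U j b ∈ U1 𝔸)
        (α : ℝ) (_hα : 0 ≤ α) (_hαle : α ≤ α₁)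
        (hUst : ∀ b, star (U b : 𝔸) = (((U b)⁻¹ : 𝔸ˣ) : 𝔸)) (_hUb : ∀ b, U b ∈ U1 𝔸) (_hUη : ∀ b, ‖(U b : 𝔸) - 1‖ ≤ α * η)
        (_hpl : ∀ p : B9SectCLatticeCarrier.Plaq d (towerP L m (n + 1)), ‖(plaqHolU U p : 𝔸) - 1‖ ≤ α * η ^ 2)
        (_hUgrad : ∀ (x : TSite d (towerP L m (n + 1))) (μ : Fin d), ‖(U (x, μ) : 𝔸) - U (unshift μ x, μ)‖ ≤ α * η ^ 2)
        (_hRlev : ∀ (j : ℕ) (b : Bond d (towerP L m (j + 1))) (w : W), ‖adTransportW φ (UlevOf L m (n + 1) U j) b w‖ ≤ ‖w‖)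
        (_hεg : ∀ j < n + 1, εU j ≤ α * ϱ ^ j) (_hAQ : ∑ j ∈ Finset.range (n + 1), αU j ≤ AQ)
        (hpos' : ∀ x : SiteL2K ℂ d (towerP L m (n + 1)) c₀ W, x ≠ 0 → 0 < RCLike.re ⟪x, laplacePrimeAk L m n φ η U a' (c₁ := c₁) x⟫_ℂ)
        (hpos : ∀ x : BondL2K ℂ d (towerP L m (n + 1)) c₀ W, x ≠ 0 →
          0 < RCLike.re ⟪x, laplaceAk L m n φ η U hL αU hα1 hU1 hreg τ (c₀ := c₀) (c₁ := c₁) a x⟫_ℂ)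
        (_hc₀η : c₀ = η ^ d) (j₀ : ℝ) (_hJ : ∀ μ y, ‖B9Eq39Adjoint.J (fun μ => B9Eq33CovDerivVector.shiftEquiv μ) (fun μ y => U (y, μ)) η μ y‖ ≤ j₀) (_hj : j₀ ≤ j₁)
        (hposπ : ∀ x : BondL2K ℂ d (towerP L m (n + 1)) c₀ W, x ≠ 0 →
          0 < RCLike.re ⟪x, laplaceAkPi L m n φ τ η U a' hpos' hL αU hα1 hU1 hreg (c₁ := c₁) a x⟫_ℂ)
        (hQ : Function.Surjective (QkW L m n φ U hL αU hα1 hU1 hreg (c₀ := c₀) (c₁ := c₁)))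
        [FiniteDimensional ℂ 𝔸] (lev₀ : Bond d (towerP L m (n + 1)) → ℕ) {κ' : Type*} [Fintype κ'] (lev₁ : κ' → ℕ)
        (Dc : (Bond d (towerP L m (n + 1)) → 𝔸) →ₗ[ℂ] (κ' → 𝔸)) (levB : Bond d m → ℕ) [Fact (0 < (L : ℝ))] [Fact (0 < η)]
        (y : Bond d m) (Z : 𝔸) (b : Bond d (towerP L m (n + 1))),
        ‖JetSup.equiv (levWeight (L : ℝ) η lev₀ 1) (levWeight (L : ℝ) η lev₁ 2) Dc
            (H1LatticeCLM (L := (L : ℝ)) (η := η) (lev₀ := lev₀) (levB := levB) φ hposπ hQ lev₁ Dc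
              ((NegSup.equiv (levWeight (L : ℝ) η levB 0) 𝔸).symm (Pi.single y Z))) b‖ ≤
          Mφ * B * Mφ' * Real.exp (-(δ * tdist m (blockCoord (L ^ (n + 1)) m (siteCast (towerP_eq_fineP_pow L m (n + 1)) (bpos b))) (bpos y))) * ‖Z‖ := by
  obtain ⟨α₁, j₁, B, δ, hα₁, hj₁, hB, hδ, HK⟩ :=
    exists_local_letter_H1LatticeKPi hd L hL hL3 φ hMφ hMφ' hφ hφ' hstar ha ha' hϱ0 hϱ1 τ hτ hCτ hτm hMτ hρw hτ₁ hτ₂ hφτ AQ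
  refine ⟨α₁, j₁, B, δ, hα₁, hj₁, hB, hδ, ?_⟩
  intro n η hηL c₀ c₁ _ _ hw hρ m _ hm U αU hα0 hα1 hαL hU1 hreg εU hεU hUε hLb α hα hαle hUst hUb hUη hpl hUgrad hRlev hεg hAQ hpos' hpos hc₀η j₀ hJ hj
    hposπ hQ _ lev₀ κ' _ lev₁ Dc levB _ _ y Z b
  -- the one-block field read in the Hilbert fibre: supported at `y₋`, values bounded by `M_φ′‖Z‖`
  have hzv : ∀ b', bpos b' ≠ bpos y → WL2.equiv ℂ (fun _ : Bond d m => c₁) W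
      ((funEquiv φ (fun _ : Bond d m => c₁)).symm (Pi.single y Z)) b' = 0 := by
    intro b' hb'
    have hne : b' ≠ y := fun h => hb' (by rw [h])
    rw [funEquiv_symm_apply, Pi.single_eq_of_ne hne, map_zero]
  have hzF : ∀ b', ‖WL2.equiv ℂ (fun _ : Bond d m => c₁) W ((funEquiv φ (fun _ : Bond d m => c₁)).symm (Pi.single y Z)) b'‖ ≤ Mφ' * ‖Z‖ := by
    intro b'
    rw [funEquiv_symm_apply]
    refine (hφ' _).trans (mul_le_mul_of_nonneg_left ?_ hMφ')
    by_cases h : b' = y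
    · rw [h, Pi.single_eq_same]
    · rw [Pi.single_eq_of_ne h, norm_zero]; exact norm_nonneg _
  have h := HK n η hηL c₀ c₁ hw hρ m hm U αU hα0 hα1 hαL hU1 hreg εU hεU hUε hLb α hα hαle hUst hUb hUη hpl hUgrad hRlev hεg hAQ hpos' hpos hc₀η j₀ hJ hj
    hposπ hQ (bpos y) ((funEquiv φ (fun _ : Bond d m => c₁)).symm (Pi.single y Z)) (Mφ' * ‖Z‖) hzv hzF b
  have e : JetSup.equiv (levWeight (L : ℝ) η lev₀ 1) (levWeight (L : ℝ) η lev₁ 2) Dc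
      (H1LatticeCLM (L := (L : ℝ)) (η := η) (lev₀ := lev₀) (levB := levB) φ hposπ hQ lev₁ Dc
        ((NegSup.equiv (levWeight (L : ℝ) η levB 0) 𝔸).symm (Pi.single y Z))) b =
      φ (WL2.equiv ℂ (fun _ : Bond d (towerP L m (n + 1)) => c₀) W (H1LatticeK hposπ hQ
        ((funEquiv φ (fun _ : Bond d m => c₁)).symm (NegSup.equiv (levWeight (L : ℝ) η levB 0) 𝔸
          ((NegSup.equiv (levWeight (L : ℝ) η levB 0) 𝔸).symm (Pi.single y Z))))) b) := rfl
  rw [e]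
  refine (hφ _).trans ?_
  calc Mφ * ‖WL2.equiv ℂ (fun _ : Bond d (towerP L m (n + 1)) => c₀) W (H1LatticeK hposπ hQ
          ((funEquiv φ (fun _ : Bond d m => c₁)).symm (NegSup.equiv (levWeight (L : ℝ) η levB 0) 𝔸
            ((NegSup.equiv (levWeight (L : ℝ) η levB 0) 𝔸).symm (Pi.single y Z))))) b‖
      ≤ Mφ * (B * Real.exp (-(δ * tdist m (blockCoord (L ^ (n + 1)) m (siteCast (towerP_eq_fineP_pow L m (n + 1)) (bpos b))) (bpos y))) * (Mφ' * ‖Z‖)) := by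
        rw [Equiv.apply_symm_apply]
        exact mul_le_mul_of_nonneg_left h hMφ
    _ = _ := by ring

end Literature.MathematicalPhysics.QuantumFieldTheory.Balaban1983to89.B9Eq3126H1kPiOneBlockColumn

end
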